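import Summits.Ventures.HodgeRepro2.T5SU11RadialGreenImproperDecaySource

/-!
# The improper Green's solution is THE bounded `φ_λ`-decaying solution: `G^I_λ` on the exponentially decaying class

For a source `g` continuous on `(0, ∞)`, bounded on `(0, 1]`, with `|g(s)| ≤ C e^{−εs}` for `s ≥ s₀` and
`ε > 2 − λ` (row 496), the improper Green's solution `u = G^I_λ g` of row 492

* **decays relative to `φ_λ`**: `u/φ_λ = −T_λ B^I − A^I → 0` (`tendsto_greenSolI_div_atTop`; `A^I → 0` as the tail of
  a convergent integral, `tendsto_greenAI_atTop`; `T_λ B^I → 0` from `T_λ ≤ 2K e^{−2(λ−1)t}` and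
  `|B^I(t)| ≤ C₀ + C′ t e^{max(λ−ε,0) t}`, `tendsto_tailIntegral_mul_greenBI_atTop`),
* is bounded at the origin (row 493) and solves `(L − μ)u = g` (row 492);

hence, by row 488's uniqueness, **every solution of `(L − μ)v = g` that is bounded at the origin and `o(φ_λ)` at
infinity equals `G^I_λ g`** (`eq_greenSolI_of_ode`): on the exponentially decaying class the resolvent
`(L − λ(λ−2))⁻¹` IS the improper variation-of-parameters operator. Nothing is claimed about (N).

Blind lane: Mathlib + the HodgeRepro2 prefix only; no sorry; axioms ⊆ {propext, Classical.choice,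
Quot.sound}.
-/

namespace Summit.Ventures.HodgeRepro2.T5SU11RadialGreenImproperUnique

open Filter Topology MeasureTheory intervalIntegral
open Set (Ioi Ioc Icc)
open T5SU11Cartan T5SU11SphericalFunction T5SU11SphericalBounds T5SU11SphericalContinuous
  T5SU11SphericalSolutionSpaceAll T5SU11ReductionOfOrder T5SU11ReductionOfOrderInfinity T5SU11SphericalDecay
  T5SU11SphericalDecayAsymptotic T5SU11ResolventBoundary T5SU11RadialGreenImproper
  T5SU11RadialGreenImproperOrigin T5SU11ResolventSourceIntegrable T5SU11RadialGreenImproperDecaySource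
  T5SU11ResolventIdentity

section measure

variable [MeasurableSpace Circle] [BorelSpace Circle]

variable {lam : ℝ} (hlam : 1 < lam) {g : ℝ → ℝ} (hg : ContinuousOn g (Ioi 0))
  {M : ℝ} (hM : ∀ s ∈ Ioc (0 : ℝ) 1, |g s| ≤ M) (hM0 : 0 ≤ M)
  {ε C s₀ : ℝ} (hε : 2 - lam < ε) (hC : ∀ s, s₀ ≤ s → |g s| ≤ C * Real.exp (-ε * s))

include hlam hg hM hM0 hε hC in
/-- **`A^I(t) → 0`** at infinity. -/
theorem tendsto_greenAI_atTop : Tendsto (greenAI (sphDecay lam) g) atTop (𝓝 0) := by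
  have hA := integrableOn_sphDecay_mul_mul_sinh hlam hg hM hM0 hε hC
  have h := (tendsto_const_nhds (x := ∫ s in Ioi 0, sphDecay lam s * g s * Real.sinh (2 * s))).sub
    (intervalIntegral_tendsto_integral_Ioi 0 hA (tendsto_id (x := atTop)))
  rw [sub_self] at h
  refine h.congr' ?_
  filter_upwards [eventually_gt_atTop 0] with t ht
  simp only [id]
  rw [greenAI_eq hA ht, integral_of_le ht.le]

include hlam hg hM hM0 hε hC in
/-- **`T_λ(t) B^I(t) → 0`** at infinity. -/
theorem tendsto_tailIntegral_mul_greenBI_atTop :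
    Tendsto (fun t => tailIntegral (fun t => sph lam (hyp t)) t * greenBI (fun t => sph lam (hyp t)) g t)
      atTop (𝓝 0) := by
  set c := T5SU11SphericalAsymptotic.cfun (2 - lam) with hc
  set K := 1 / ((lam - 1) * T5SU11SphericalAsymptotic.cfun (2 - lam) ^ 2) with hK
  have hcpos : 0 < c := T5SU11SphericalCfun.cfun_pos (by linarith)
  have hKpos : 0 < K := by
    rw [hK]
    exact div_pos one_pos (mul_pos (by linarith) (pow_pos hcpos 2))
  obtain ⟨T₀, hT₀⟩ := eventually_atTop.mp (eventually_sph_hyp_le hlam)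
  obtain ⟨T₂, hT₂⟩ := eventually_atTop.mp (eventually_tailIntegral_le hlam)
  set T := max (max T₀ s₀) (max T₂ 1) with hT
  have h1T : 1 ≤ T := le_trans (le_max_right _ _) (le_max_right _ _)
  have hT0 : 0 < T := lt_of_lt_of_le one_pos h1T
  set Mx := max (lam - ε) 0 with hMx
  have hMx0 : 0 ≤ Mx := le_max_right _ _
  -- the integrand on `[T, ∞)`
  set C' := 2 * c * |C| / 2 with hC'
  have hC'0 : 0 ≤ C' := by positivity
  have hpt : ∀ s, T ≤ s → |sph lam (hyp s) * g s * Real.sinh (2 * s)| ≤ C' * Real.exp ((lam - ε) * s) := by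
    intro s hs
    have hs0 : 0 < s := lt_of_lt_of_le hT0 hs
    have hb0 := hT₀ s (le_trans (le_trans (le_max_left _ _) (le_max_left _ _)) hs)
    have hgs := hC s (le_trans (le_trans (le_max_right _ _) (le_max_left _ _)) hs)
    have hCexp : C * Real.exp (-ε * s) ≤ |C| * Real.exp (-ε * s) :=
      mul_le_mul_of_nonneg_right (le_abs_self C) (Real.exp_pos _).le
    have hsh : Real.sinh (2 * s) ≤ Real.exp (2 * s) / 2 := sinh_le_exp_div_two _
    have hsh0 : 0 ≤ Real.sinh (2 * s) := Real.sinh_nonneg_iff.mpr (by linarith)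
    rw [abs_mul, abs_mul, abs_of_pos (sph_hyp_pos lam s), abs_of_nonneg hsh0]
    calc sph lam (hyp s) * |g s| * Real.sinh (2 * s)
        ≤ (2 * c * Real.exp ((lam - 2) * s)) * (|C| * Real.exp (-ε * s)) * (Real.exp (2 * s) / 2) :=
          mul_le_mul (mul_le_mul hb0 (le_trans hgs hCexp) (abs_nonneg _) (by positivity)) hsh hsh0
            (by positivity)
      _ = C' * Real.exp ((lam - ε) * s) := by
          rw [hC', show Real.exp ((lam - ε) * s)
              = Real.exp ((lam - 2) * s) * Real.exp (-ε * s) * Real.exp (2 * s) by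
            rw [← Real.exp_add, ← Real.exp_add]; congr 1; ring]
          ring
  -- `|B^I(t)| ≤ C₀ + C′ e^{Mx t} t` for `t ≥ T`
  set C₀ := ∫ s in Ioc 0 T, |sph lam (hyp s) * g s * Real.sinh (2 * s)| with hC₀
  have hBint := integrableOn_sph_mul_mul_sinh_Ioc hg hM hM0 lam
  have hBle : ∀ t, T ≤ t → |greenBI (fun t => sph lam (hyp t)) g t| ≤ C₀ + C' * Real.exp (Mx * t) * t := by
    intro t ht
    unfold greenBI
    have hsplit : Ioc 0 T ∪ Ioc T t = Ioc 0 t := Set.Ioc_union_Ioc_eq_Ioc hT0.le ht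
    have hdisj : Disjoint (Ioc 0 T) (Ioc T t) := Set.Ioc_disjoint_Ioc_of_le le_rfl
    rw [← hsplit, setIntegral_union hdisj measurableSet_Ioc
      ((hBint t).mono_set (by rw [← hsplit]; exact Set.subset_union_left))
      ((hBint t).mono_set (by rw [← hsplit]; exact Set.subset_union_right))]
    refine le_trans (abs_add_le _ _) (add_le_add ?_ ?_)
    · have := norm_integral_le_integral_norm (μ := volume.restrict (Ioc 0 T))
        (fun s => sph lam (hyp s) * g s * Real.sinh (2 * s))
      simpa only [Real.norm_eq_abs] using this
    · have h := norm_setIntegral_le_of_norm_le_const (μ := volume) (s := Ioc T t)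
        (f := fun s => sph lam (hyp s) * g s * Real.sinh (2 * s)) (C := C' * Real.exp (Mx * t))
        (by rw [Real.volume_Ioc]; exact ENNReal.ofReal_lt_top) (fun s hs => ?_)
      · rw [Real.norm_eq_abs, Real.volume_real_Ioc_of_le ht] at h
        calc |∫ s in Ioc T t, sph lam (hyp s) * g s * Real.sinh (2 * s)|
            ≤ C' * Real.exp (Mx * t) * (t - T) := h
          _ ≤ C' * Real.exp (Mx * t) * t := mul_le_mul_of_nonneg_left (by linarith) (by positivity)
      · rw [Real.norm_eq_abs]
        refine le_trans (hpt s hs.1.le) (mul_le_mul_of_nonneg_left (Real.exp_le_exp.mpr ?_) hC'0)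
        have hs0 : 0 ≤ s := le_trans hT0.le hs.1.le
        calc (lam - ε) * s ≤ Mx * s := mul_le_mul_of_nonneg_right (le_max_left _ _) hs0
          _ ≤ Mx * t := mul_le_mul_of_nonneg_left hs.2 hMx0
  -- the limit
  have hlim : Tendsto (fun t => 2 * K * Real.exp (-(2 * (lam - 1)) * t) * C₀
      + 2 * K * C' * (t * Real.exp (-(2 * (lam - 1) - Mx) * t))) atTop (𝓝 0) := by
    have h1 : Tendsto (fun t => Real.exp (-(2 * (lam - 1)) * t)) atTop (𝓝 0) := by
      have := Real.tendsto_exp_neg_atTop_nhds_zero.comp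
        (tendsto_id.const_mul_atTop (by linarith : 0 < 2 * (lam - 1)))
      refine this.congr' (Eventually.of_forall fun t => ?_)
      simp only [Function.comp_def, id]
      ring_nf
    have h2 : Tendsto (fun t => t * Real.exp (-(2 * (lam - 1) - Mx) * t)) atTop (𝓝 0) := by
      refine tendsto_mul_exp_neg_mul_atTop ?_
      rw [hMx]
      rcases le_or_gt 0 (lam - ε) with h | h
      · rw [max_eq_left h]; linarith
      · rw [max_eq_right h.le]; linarith
    have := ((h1.const_mul (2 * K)).mul_const C₀).add (h2.const_mul (2 * K * C'))
    simpa only [mul_zero, zero_mul, add_zero] using this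
  refine squeeze_zero_norm' ?_ hlim
  filter_upwards [eventually_ge_atTop T] with t ht
  have hTle := hT₂ t (le_trans (le_trans (le_max_left _ _) (le_max_right _ _)) ht)
  have hTpos : 0 < tailIntegral (fun t => sph lam (hyp t)) t :=
    tailIntegral_pos (hφ_sph lam) (hpos_sph lam) (integrableOn_roIntegrand_sph hlam) (lt_of_lt_of_le hT0 ht)
  rw [Real.norm_eq_abs, abs_mul, abs_of_pos hTpos]
  calc tailIntegral (fun t => sph lam (hyp t)) t * |greenBI (fun t => sph lam (hyp t)) g t|
      ≤ (2 * K * Real.exp (-(2 * (lam - 1)) * t)) * (C₀ + C' * Real.exp (Mx * t) * t) :=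
        mul_le_mul hTle (hBle t ht) (abs_nonneg _) (by positivity)
    _ = 2 * K * Real.exp (-(2 * (lam - 1)) * t) * C₀
        + 2 * K * C' * (t * Real.exp (-(2 * (lam - 1) - Mx) * t)) := by
        rw [show Real.exp (-(2 * (lam - 1) - Mx) * t) = Real.exp (-(2 * (lam - 1)) * t) * Real.exp (Mx * t) by
          rw [← Real.exp_add]; congr 1; ring]
        ring

include hlam hg hM hM0 hε hC in
/-- **`G^I_λ g / φ_λ → 0`** at infinity. -/
theorem tendsto_greenSolI_div_atTop :
    Tendsto (fun t => greenSolI (fun t => sph lam (hyp t)) (sphDecay lam) g t / sph lam (hyp t)) atTop (𝓝 0) := by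
  have h := ((tendsto_tailIntegral_mul_greenBI_atTop hlam hg hM hM0 hε hC).neg).sub
    (tendsto_greenAI_atTop hlam hg hM hM0 hε hC)
  rw [neg_zero, sub_zero] at h
  refine h.congr' (Eventually.of_forall fun t => ?_)
  have hφ : sph lam (hyp t) ≠ 0 := (sph_hyp_pos lam t).ne'
  show -(tailIntegral (fun t => sph lam (hyp t)) t * greenBI (fun t => sph lam (hyp t)) g t)
    - greenAI (sphDecay lam) g t
    = (-(sphDecay lam t * greenBI (fun t => sph lam (hyp t)) g t) - sph lam (hyp t) * greenAI (sphDecay lam) g t)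
      / sph lam (hyp t)
  have hχ : sphDecay lam t = sph lam (hyp t) * tailIntegral (fun t => sph lam (hyp t)) t := rfl
  rw [hχ]
  field_simp

include hlam hg hM hM0 hε hC in
/-- **`G^I_λ g` IS THE RESOLVENT ON THE EXPONENTIALLY DECAYING CLASS**: every solution `v` of
`sinh 2t · v″ + 2 cosh 2t · v′ = λ(λ−2) sinh 2t · v + sinh 2t · g` on `(0, ∞)` that is bounded at the origin and
`o(φ_λ)` at infinity equals `G^I_λ g`. -/
theorem eq_greenSolI_of_ode {v v' v'' : ℝ → ℝ}
    (hv : ∀ t, 0 < t → HasDerivAt v (v' t) t) (hv' : ∀ t, 0 < t → HasDerivAt v' (v'' t) t)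
    (hvode : ∀ t, 0 < t → Real.sinh (2 * t) * v'' t + 2 * Real.cosh (2 * t) * v' t
      = lam * (lam - 2) * Real.sinh (2 * t) * v t + Real.sinh (2 * t) * g t)
    {B : ℝ} (hB : ∀ᶠ t in 𝓝[>] (0 : ℝ), |v t| ≤ B)
    (hdecay : Tendsto (fun t => v t / sph lam (hyp t)) atTop (𝓝 0)) {t : ℝ} (ht : 0 < t) :
    v t = greenSolI (fun t => sph lam (hyp t)) (sphDecay lam) g t := by
  have hBi := integrableOn_sph_mul_mul_sinh_Ioc hg hM hM0 lam
  have hA := integrableOn_sphDecay_mul_mul_sinh hlam hg hM hM0 hε hC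
  obtain ⟨B', hB'⟩ := eventually_abs_greenSolI_le hlam hM hM0 hA
  exact eq_of_ode_of_bounded_of_decay lam hv hv' hvode
    (fun _ hs => hasDerivAt_greenSolI (hφ_sph lam) (fun _ hs => hasDerivAt_sphDecay hlam hs) hg hBi hA hs)
    (fun _ hs => hasDerivAt_greenSolI' (hφ_sph lam) (hφ'_sph lam) (fun _ hs => hasDerivAt_sphDecay hlam hs)
      (fun _ hs => hasDerivAt_sphDecay' lam hs) hg hBi hA hs)
    (fun _ hs => greenSolI_ode (hode_sph lam) (fun _ hs => sphDecay_ode hlam hs)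
      (fun _ hs => wronskian_sphDecay hlam hs) (g := g) hs)
    hB hB' hdecay (tendsto_greenSolI_div_atTop hlam hg hM hM0 hε hC) ht

end measure

end Summit.Ventures.HodgeRepro2.T5SU11RadialGreenImproperUnique
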